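import Summits.AtomisticToContinuum.HydrodynamicLimit.Theorems.OneFlightGossipEngineEquilibriumHeatFluxVarianceDecayApriori

/-!
# Two-time correlations of the fast heat flux under the stationary canonical law (support file 3 for C4)

Support lemmas for the route item `EquilibriumHeatFluxVarianceDecay` (stmt-AtomisticToContinuum-9532, route
OneFlightGossipEngine): stationarity of two-time correlations `E_λ[Y∘Φ_r · Y∘Φ_s] = C(|s − r|)`,
`C(u) = E_λ[Y · Y∘Φ_u]` (group property on the good set + invariance of `λ`), integrability of the autocorrelation
kernel on `(0, w] × λ` and of `C` on windows, the elementary window estimate `∫₀ʷ c(|s−r|) dr ≤ 2∫₀ʷ c`, and the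
normalisation check `|C(u)| ≤ E_λ[Y²]`, hence `(N+1)·w⁻¹∫₀ʷ|C| ≤ K² 𝐦₂[θ₀]` (`succ_mul_cesaro_abs_corr_le`).
Inputs of the Green–Kubo inequality of file 4. prover-pitem-stmt-AtomisticToContinuum-9532-0.
-/

noncomputable section

namespace Summit.AtomisticToContinuum.HydrodynamicLimit.Theorems

open MeasureTheory ProbabilityTheory Filter Topology Set
open Literature.Analysis.FluidPDE Literature.MathematicalPhysics.KineticTheory
open scoped InnerProductSpace ENNReal
open BoltzmannGreenKuboOrthMomentum

namespace OneFlightGossipEngineHeatFlux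

section Correlations

variable {a₀ θ₀ σ : ℝ} {N : ℕ}

/-! ## Two elementary lemmas -/

/-- AM–GM domination: `f g ∈ L¹` as soon as `f², g² ∈ L¹`. [folklore] -/
theorem integrable_mul_of_sq_sq {α : Type*} [MeasurableSpace α] {μ : Measure α} {f g : α → ℝ}
    (hfm : AEStronglyMeasurable f μ) (hgm : AEStronglyMeasurable g μ)
    (hf : Integrable (fun x => f x ^ 2) μ) (hg : Integrable (fun x => g x ^ 2) μ) :
    Integrable (fun x => f x * g x) μ := by
  have hdom : Integrable (fun x => (f x ^ 2 + g x ^ 2) / 2) μ := (hf.add hg).div_const 2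
  refine hdom.mono' (hfm.mul hgm) (Eventually.of_forall fun x => ?_)
  rw [Real.norm_eq_abs, abs_mul]
  nlinarith [sq_nonneg (|f x| - |g x|), sq_abs (f x), sq_abs (g x), abs_nonneg (f x), abs_nonneg (g x)]

/-- **Window integral of an even-in-the-lag kernel**: for `c ≥ 0` integrable on `[0, w]` and `s ∈ [0, w]`,
`∫₀ʷ c(|s − r|) dr ≤ 2 ∫₀ʷ c(u) du` (split at `r = s` and substitute `u = s − r`, `u = r − s`). [folklore] -/
theorem integral_comp_abs_sub_le {c : ℝ → ℝ} (hc : ∀ u, 0 ≤ c u) {w s : ℝ} (hs : s ∈ Icc 0 w)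
    (hci : IntervalIntegrable c volume 0 w) :
    ∫ r in (0 : ℝ)..w, c (|s - r|) ≤ 2 * ∫ u in (0 : ℝ)..w, c u := by
  obtain ⟨hs0, hsw⟩ := hs
  have hw : 0 ≤ w := hs0.trans hsw
  -- integrability of the two substituted pieces
  have hleft : IntervalIntegrable (fun r => c (s - r)) volume 0 s := by
    have h1 : IntervalIntegrable c volume 0 s :=
      hci.mono_set (by rw [uIcc_of_le hs0, uIcc_of_le hw]; exact Icc_subset_Icc le_rfl hsw)
    have h2 := h1.comp_sub_left s
    simp only [sub_zero, sub_self] at h2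
    exact h2.symm
  have hright : IntervalIntegrable (fun r => c (r - s)) volume s w := by
    have h1 : IntervalIntegrable c volume 0 (w - s) :=
      hci.mono_set (by rw [uIcc_of_le (sub_nonneg.2 hsw), uIcc_of_le hw]; exact Icc_subset_Icc le_rfl (by linarith))
    have h2 := h1.comp_sub_right s
    simp only [zero_add, sub_add_cancel] at h2
    exact h2
  have hleft' : IntervalIntegrable (fun r => c (|s - r|)) volume 0 s := by
    refine (intervalIntegrable_congr fun r hr => ?_).2 hleft
    rw [uIoc_of_le hs0] at hr
    show c (|s - r|) = c (s - r)
    rw [abs_of_nonneg (sub_nonneg.2 hr.2)]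
  have hright' : IntervalIntegrable (fun r => c (|s - r|)) volume s w := by
    refine (intervalIntegrable_congr fun r hr => ?_).2 hright
    rw [uIoc_of_le hsw] at hr
    show c (|s - r|) = c (r - s)
    rw [abs_sub_comm, abs_of_nonneg (sub_nonneg.2 hr.1.le)]
  rw [← intervalIntegral.integral_add_adjacent_intervals hleft' hright']
  -- evaluate the two pieces
  have e1 : ∫ r in (0 : ℝ)..s, c (|s - r|) = ∫ u in (0 : ℝ)..s, c u := by
    rw [intervalIntegral.integral_congr (g := fun r => c (s - r)) fun r hr => by
      rw [uIcc_of_le hs0] at hr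
      show c (|s - r|) = c (s - r)
      rw [abs_of_nonneg (sub_nonneg.2 hr.2)]]
    rw [intervalIntegral.integral_comp_sub_left (fun u => c u) s]
    simp
  have e2 : ∫ r in s..w, c (|s - r|) = ∫ u in (0 : ℝ)..(w - s), c u := by
    rw [intervalIntegral.integral_congr (g := fun r => c (r - s)) fun r hr => by
      rw [uIcc_of_le hsw] at hr
      show c (|s - r|) = c (r - s)
      rw [abs_sub_comm, abs_of_nonneg (sub_nonneg.2 hr.1)]]
    rw [intervalIntegral.integral_comp_sub_right (fun u => c u) s]
    simp
  have hnn : 0 ≤ᵐ[volume.restrict (Ioc (0 : ℝ) w)] c := Eventually.of_forall fun u => hc u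
  have b1 : ∫ u in (0 : ℝ)..s, c u ≤ ∫ u in (0 : ℝ)..w, c u :=
    intervalIntegral.integral_mono_interval le_rfl hs0 hsw hnn hci
  have b2 : ∫ u in (0 : ℝ)..(w - s), c u ≤ ∫ u in (0 : ℝ)..w, c u :=
    intervalIntegral.integral_mono_interval le_rfl (sub_nonneg.2 hsw) (by linarith) hnn hci
  rw [e1, e2]
  linarith

/-! ## Time-shifted observables under the stationary law -/

/-- `Y ∘ Φ_t ∈ L¹(λ)` (invariance of `λ`). [folklore] -/
theorem integrable_Yobs_comp_flow (ha : 0 < a₀) (hθ : 0 < θ₀) (hσ : σ ≤ 1 / 2) (N : ℕ)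
    (Φ : HardSphereFlow (Torus.geometry (Fin 3)) (hsDiameter σ N) (N + 1))
    {φ : T3 → ℝ} (hφ : Continuous φ) {K : ℝ} (hφK : ∀ y, |φ y| ≤ K) (t : ℝ) :
    Integrable (fun z => 𝐘[N, θ₀, φ, Φ.flow t z]) (localGibbsLaw σ (fun _ => a₀) (fun _ => 0) (fun _ => θ₀) N Φ) :=
  ((measurePreserving_flow_localGibbsLaw a₀ θ₀ 0 Φ t).integrable_comp
    (measurable_Yobs θ₀ hφ).aestronglyMeasurable).2 (integrable_Yobs ha hθ hσ N Φ hφ hφK)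

/-- `(Y ∘ Φ_t)² ∈ L¹(λ)` (invariance of `λ`). [folklore] -/
theorem integrable_Yobs_comp_flow_sq (ha : 0 < a₀) (hθ : 0 < θ₀) (hσ : σ ≤ 1 / 2) (N : ℕ)
    (Φ : HardSphereFlow (Torus.geometry (Fin 3)) (hsDiameter σ N) (N + 1))
    {φ : T3 → ℝ} (hφ : Continuous φ) {K : ℝ} (hφK : ∀ y, |φ y| ≤ K) (t : ℝ) :
    Integrable (fun z => 𝐘[N, θ₀, φ, Φ.flow t z] ^ 2) (localGibbsLaw σ (fun _ => a₀) (fun _ => 0) (fun _ => θ₀) N Φ) :=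
  ((measurePreserving_flow_localGibbsLaw a₀ θ₀ 0 Φ t).integrable_comp
    ((measurable_Yobs θ₀ hφ).pow_const 2).aestronglyMeasurable).2 (integrable_Yobs_sq ha hθ hσ N Φ hφ hφK)

/-- **Stationarity of two-time correlations**: `E_λ[Y(Φ_r ·) Y(Φ_s ·)] = E_λ[Y · Y(Φ_{s−r} ·)]` (group property on
the good set + invariance of `λ` under `Φ_r`). [folklore] -/
theorem integral_flow_mul_flow (ha : 0 < a₀) (hθ : 0 < θ₀) (hσ : σ ≤ 1 / 2) (N : ℕ)
    (Φ : HardSphereFlow (Torus.geometry (Fin 3)) (hsDiameter σ N) (N + 1))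
    {φ : T3 → ℝ} (hφ : Continuous φ) (r s : ℝ) :
    ∫ z, 𝐘[N, θ₀, φ, Φ.flow r z] * 𝐘[N, θ₀, φ, Φ.flow s z] ∂(localGibbsLaw σ (fun _ => a₀) (fun _ => 0) (fun _ => θ₀) N Φ) =
      ∫ z, 𝐘[N, θ₀, φ, z] * 𝐘[N, θ₀, φ, Φ.flow (s - r) z] ∂(localGibbsLaw σ (fun _ => a₀) (fun _ => 0) (fun _ => θ₀) N Φ) := by
  have _ := ha; have _ := hθ; have _ := hσ
  set G := localGibbsLaw σ (fun _ => a₀) (fun _ => (0 : V3)) (fun _ => θ₀) N Φ with hGdef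
  have hae : (fun z => 𝐘[N, θ₀, φ, Φ.flow r z] * 𝐘[N, θ₀, φ, Φ.flow s z]) =ᵐ[G]
      fun z => (fun y : Config (N + 1) (Fin 3) T3 => 𝐘[N, θ₀, φ, y] * 𝐘[N, θ₀, φ, Φ.flow (s - r) y]) (Φ.flow r z) := by
    filter_upwards [ae_mem_good_localGibbsLaw' (N := N) a₀ θ₀ 0 Φ] with z hz
    have h : Φ.flow s z = Φ.flow (s - r) (Φ.flow r z) := by
      rw [← Φ.flow_add (s - r) r z hz, sub_add_cancel]
    simp only [h]
  rw [integral_congr_ae hae]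
  have hFm : Measurable fun y : Config (N + 1) (Fin 3) T3 => 𝐘[N, θ₀, φ, y] * 𝐘[N, θ₀, φ, Φ.flow (s - r) y] :=
    (measurable_Yobs θ₀ hφ).mul ((measurable_Yobs θ₀ hφ).comp (Φ.measurable_flow (s - r)))
  have h2 := integral_map (Φ.measurable_flow r).aemeasurable (hFm.aestronglyMeasurable (μ := G.map (Φ.flow r)))
  rw [(measurePreserving_flow_localGibbsLaw a₀ θ₀ 0 Φ r).map_eq] at h2
  exact h2.symm

/-- Two-time correlations depend on the ABSOLUTE lag only: `E_λ[Y(Φ_r ·) Y(Φ_s ·)] = C(|s − r|)` with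
`C(u) = E_λ[Y · Y(Φ_u ·)]`. [folklore] -/
theorem integral_flow_mul_flow_eq_abs (ha : 0 < a₀) (hθ : 0 < θ₀) (hσ : σ ≤ 1 / 2) (N : ℕ)
    (Φ : HardSphereFlow (Torus.geometry (Fin 3)) (hsDiameter σ N) (N + 1))
    {φ : T3 → ℝ} (hφ : Continuous φ) (r s : ℝ) :
    ∫ z, 𝐘[N, θ₀, φ, Φ.flow r z] * 𝐘[N, θ₀, φ, Φ.flow s z] ∂(localGibbsLaw σ (fun _ => a₀) (fun _ => 0) (fun _ => θ₀) N Φ) =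
      ∫ z, 𝐘[N, θ₀, φ, z] * 𝐘[N, θ₀, φ, Φ.flow |s - r| z] ∂(localGibbsLaw σ (fun _ => a₀) (fun _ => 0) (fun _ => θ₀) N Φ) := by
  rcases le_total r s with h | h
  · rw [integral_flow_mul_flow ha hθ hσ N Φ hφ, abs_of_nonneg (sub_nonneg.2 h)]
  · rw [show (fun z => 𝐘[N, θ₀, φ, Φ.flow r z] * 𝐘[N, θ₀, φ, Φ.flow s z]) =
        fun z => 𝐘[N, θ₀, φ, Φ.flow s z] * 𝐘[N, θ₀, φ, Φ.flow r z] from funext fun z => mul_comm _ _,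
      integral_flow_mul_flow ha hθ hσ N Φ hφ, abs_sub_comm, abs_of_nonneg (sub_nonneg.2 h)]

/-- The autocorrelation kernel `(t, z) ↦ Y(z) Y(Φ_t z)` is integrable on `(0, w] × λ`. [folklore] -/
theorem integrable_prod_Yobs_mul_flow (ha : 0 < a₀) (hθ : 0 < θ₀) (hσ : σ ≤ 1 / 2) (N : ℕ)
    (Φ : HardSphereFlow (Torus.geometry (Fin 3)) (hsDiameter σ N) (N + 1))
    {φ : T3 → ℝ} (hφ : Continuous φ) {K : ℝ} (hφK : ∀ y, |φ y| ≤ K) (w : ℝ) :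
    Integrable (fun p : ℝ × Config (N + 1) (Fin 3) T3 => 𝐘[N, θ₀, φ, p.2] * 𝐘[N, θ₀, φ, Φ.flow p.1 p.2])
      ((volume.restrict (Ioc (0 : ℝ) w)).prod (localGibbsLaw σ (fun _ => a₀) (fun _ => 0) (fun _ => θ₀) N Φ)) := by
  haveI : IsProbabilityMeasure (localGibbsLaw σ (fun _ => a₀) (fun _ => (0 : V3)) (fun _ => θ₀) N Φ) :=
    isProbabilityMeasure_localGibbsLaw continuous_const continuous_const continuous_const
      (fun _ => ha) (fun _ => hθ) hσ N Φ
  haveI : IsFiniteMeasure (volume.restrict (Ioc (0 : ℝ) w)) := ⟨by simp [Real.volume_Ioc]⟩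
  have hflow := integrable_comp_flow_prod a₀ θ₀ 0 Φ ((measurable_Yobs θ₀ hφ).pow_const 2)
    (integrable_Yobs_sq ha hθ hσ N Φ hφ hφK) w
  have hflow1 := integrable_comp_flow_prod a₀ θ₀ 0 Φ (measurable_Yobs θ₀ hφ)
    (integrable_Yobs ha hθ hσ N Φ hφ hφK) w
  have hstat : Integrable (fun p : ℝ × Config (N + 1) (Fin 3) T3 => 𝐘[N, θ₀, φ, p.2] ^ 2)
      ((volume.restrict (Ioc (0 : ℝ) w)).prod (localGibbsLaw σ (fun _ => a₀) (fun _ => 0) (fun _ => θ₀) N Φ)) := by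
    simpa using (integrable_const (1 : ℝ)).mul_prod (integrable_Yobs_sq ha hθ hσ N Φ hφ hφK)
  exact integrable_mul_of_sq_sq ((measurable_Yobs θ₀ hφ).comp measurable_snd).aestronglyMeasurable
    hflow1.aestronglyMeasurable hstat hflow

/-- The autocorrelation `C(t) = E_λ[Y · Y(Φ_t ·)]` is integrable on every window `[0, w]`. [folklore] -/
theorem intervalIntegrable_corr (ha : 0 < a₀) (hθ : 0 < θ₀) (hσ : σ ≤ 1 / 2) (N : ℕ)
    (Φ : HardSphereFlow (Torus.geometry (Fin 3)) (hsDiameter σ N) (N + 1))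
    {φ : T3 → ℝ} (hφ : Continuous φ) {K : ℝ} (hφK : ∀ y, |φ y| ≤ K) {w : ℝ} (hw : 0 ≤ w) :
    IntervalIntegrable (fun t => ∫ z, 𝐘[N, θ₀, φ, z] * 𝐘[N, θ₀, φ, Φ.flow t z]
      ∂(localGibbsLaw σ (fun _ => a₀) (fun _ => 0) (fun _ => θ₀) N Φ)) volume 0 w := by
  haveI : IsProbabilityMeasure (localGibbsLaw σ (fun _ => a₀) (fun _ => (0 : V3)) (fun _ => θ₀) N Φ) :=
    isProbabilityMeasure_localGibbsLaw continuous_const continuous_const continuous_const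
      (fun _ => ha) (fun _ => hθ) hσ N Φ
  exact (intervalIntegrable_iff_integrableOn_Ioc_of_le hw).2
    (integrable_prod_Yobs_mul_flow ha hθ hσ N Φ hφ hφK w).integral_prod_left

/-! ## The hypothesis is correctly normalised: `(N+1)|C_N(u)| ≤ K² m₂(θ₀)` for every lag -/

/-- **The autocorrelation never exceeds the static second moment**: `|E_λ[Y · Y∘Φ_u]| ≤ E_λ[Y²]`
(`|ab| ≤ (a² + b²)/2` and invariance of `λ` under `Φ_u`). [folklore] -/
theorem abs_corr_le_integral_sq (ha : 0 < a₀) (hθ : 0 < θ₀) (hσ : σ ≤ 1 / 2) (N : ℕ)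
    (Φ : HardSphereFlow (Torus.geometry (Fin 3)) (hsDiameter σ N) (N + 1))
    {φ : T3 → ℝ} (hφ : Continuous φ) {K : ℝ} (hφK : ∀ y, |φ y| ≤ K) (u : ℝ) :
    |∫ z, 𝐘[N, θ₀, φ, z] * 𝐘[N, θ₀, φ, Φ.flow u z] ∂(localGibbsLaw σ (fun _ => a₀) (fun _ => 0) (fun _ => θ₀) N Φ)| ≤
      ∫ z, 𝐘[N, θ₀, φ, z] ^ 2 ∂(localGibbsLaw σ (fun _ => a₀) (fun _ => 0) (fun _ => θ₀) N Φ) := by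
  set G := localGibbsLaw σ (fun _ => a₀) (fun _ => (0 : V3)) (fun _ => θ₀) N Φ with hGdef
  have h1 := integrable_Yobs_sq ha hθ hσ N Φ hφ hφK
  have h2 := integrable_Yobs_comp_flow_sq ha hθ hσ N Φ hφ hφK u
  have hstat : ∫ z, 𝐘[N, θ₀, φ, Φ.flow u z] ^ 2 ∂G = ∫ z, 𝐘[N, θ₀, φ, z] ^ 2 ∂G := by
    have h := integral_map (Φ.measurable_flow u).aemeasurable
      ((((measurable_Yobs θ₀ hφ).pow_const 2)).aestronglyMeasurable (μ := G.map (Φ.flow u)))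
    rw [(measurePreserving_flow_localGibbsLaw a₀ θ₀ 0 Φ u).map_eq] at h
    exact h.symm
  calc |∫ z, 𝐘[N, θ₀, φ, z] * 𝐘[N, θ₀, φ, Φ.flow u z] ∂G|
      ≤ ∫ z, |𝐘[N, θ₀, φ, z] * 𝐘[N, θ₀, φ, Φ.flow u z]| ∂G := abs_integral_le_integral_abs
    _ ≤ ∫ z, (𝐘[N, θ₀, φ, z] ^ 2 + 𝐘[N, θ₀, φ, Φ.flow u z] ^ 2) / 2 ∂G := by
        refine integral_mono_of_nonneg (Eventually.of_forall fun z => abs_nonneg _) ((h1.add h2).div_const 2)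
          (Eventually.of_forall fun z => ?_)
        show |𝐘[N, θ₀, φ, z] * 𝐘[N, θ₀, φ, Φ.flow u z]| ≤ (𝐘[N, θ₀, φ, z] ^ 2 + 𝐘[N, θ₀, φ, Φ.flow u z] ^ 2) / 2
        rw [abs_mul]
        nlinarith [sq_nonneg (|𝐘[N, θ₀, φ, z]| - |𝐘[N, θ₀, φ, Φ.flow u z]|), sq_abs (𝐘[N, θ₀, φ, z]),
          sq_abs (𝐘[N, θ₀, φ, Φ.flow u z])]
    _ = ∫ z, 𝐘[N, θ₀, φ, z] ^ 2 ∂G := by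
        rw [integral_div, integral_add h1 h2, hstat]
        ring

/-- **The hypothesis of the reduction is correctly normalised**: for every `N`, window `w > 0`, flow and
`|φ| ≤ K`, `(N+1) · w⁻¹∫₀ʷ |E_λ[Y · Y∘Φ_u]| du ≤ K² m₂(θ₀)` — the Cesàro mean of the absolute autocorrelation is
bounded by the static value, so (like the item) only its `τ → ∞` decay has content. [folklore] -/
theorem succ_mul_cesaro_abs_corr_le (ha : 0 < a₀) (hθ : 0 < θ₀) (hσ : σ ≤ 1 / 2) (N : ℕ)
    (Φ : HardSphereFlow (Torus.geometry (Fin 3)) (hsDiameter σ N) (N + 1))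
    {φ : T3 → ℝ} (hφ : Continuous φ) {K : ℝ} (hφK : ∀ y, |φ y| ≤ K) {w : ℝ} (hw : 0 < w) :
    ((N : ℝ≥0∞) + 1) * ENNReal.ofReal (w⁻¹ * ∫ u in (0 : ℝ)..w, |∫ z, 𝐘[N, θ₀, φ, z] * 𝐘[N, θ₀, φ, Φ.flow u z]
        ∂(localGibbsLaw σ (fun _ => a₀) (fun _ => 0) (fun _ => θ₀) N Φ)|) ≤
      ENNReal.ofReal (K ^ 2 * 𝐦₂[θ₀]) := by
  set G := localGibbsLaw σ (fun _ => a₀) (fun _ => (0 : V3)) (fun _ => θ₀) N Φ with hGdef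
  set E2 : ℝ := ∫ z, 𝐘[N, θ₀, φ, z] ^ 2 ∂G with hE2
  have hE2le : E2 ≤ ((N : ℝ) + 1)⁻¹ * (K ^ 2 * 𝐦₂[θ₀]) := by
    have h := lintegral_Yobs_sq_le ha hθ hσ N Φ hφ hφK
    rw [← ofReal_integral_eq_lintegral_ofReal (integrable_Yobs_sq ha hθ hσ N Φ hφ hφK)
      (Eventually.of_forall fun z => sq_nonneg _)] at h
    exact (ENNReal.ofReal_le_ofReal_iff (mul_nonneg (inv_nonneg.2 (by positivity))
      (mul_nonneg (sq_nonneg _) (m2_nonneg θ₀)))).1 h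
  have hces : w⁻¹ * ∫ u in (0 : ℝ)..w, |∫ z, 𝐘[N, θ₀, φ, z] * 𝐘[N, θ₀, φ, Φ.flow u z] ∂G| ≤ E2 := by
    have hI : ‖∫ u in (0 : ℝ)..w, |∫ z, 𝐘[N, θ₀, φ, z] * 𝐘[N, θ₀, φ, Φ.flow u z] ∂G|‖ ≤ E2 * |w - 0| :=
      intervalIntegral.norm_integral_le_of_norm_le_const fun u _ => by
        rw [Real.norm_eq_abs, abs_abs]
        exact abs_corr_le_integral_sq ha hθ hσ N Φ hφ hφK u
    rw [sub_zero, abs_of_pos hw, Real.norm_eq_abs,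
      abs_of_nonneg (intervalIntegral.integral_nonneg hw.le fun u _ => abs_nonneg _)] at hI
    calc w⁻¹ * ∫ u in (0 : ℝ)..w, |∫ z, 𝐘[N, θ₀, φ, z] * 𝐘[N, θ₀, φ, Φ.flow u z] ∂G| ≤ w⁻¹ * (E2 * w) :=
          mul_le_mul_of_nonneg_left hI (inv_nonneg.2 hw.le)
      _ = E2 := by field_simp
  have hN : (0 : ℝ) < (N : ℝ) + 1 := by positivity
  have hcast : ((N : ℝ≥0∞) + 1) = ENNReal.ofReal ((N : ℝ) + 1) := by
    rw [ENNReal.ofReal_add (Nat.cast_nonneg N) zero_le_one, ENNReal.ofReal_natCast, ENNReal.ofReal_one]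
  rw [hcast, ← ENNReal.ofReal_mul hN.le]
  refine ENNReal.ofReal_le_ofReal ?_
  calc ((N : ℝ) + 1) * (w⁻¹ * ∫ u in (0 : ℝ)..w, |∫ z, 𝐘[N, θ₀, φ, z] * 𝐘[N, θ₀, φ, Φ.flow u z] ∂G|)
      ≤ ((N : ℝ) + 1) * (((N : ℝ) + 1)⁻¹ * (K ^ 2 * 𝐦₂[θ₀])) :=
        mul_le_mul_of_nonneg_left (hces.trans hE2le) hN.le
    _ = K ^ 2 * 𝐦₂[θ₀] := by field_simp

end Correlations

end OneFlightGossipEngineHeatFlux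

end Summit.AtomisticToContinuum.HydrodynamicLimit.Theorems

end
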